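import Mathlib
import Literature.NumberTheory.Transcendental.LinEDS
import Literature.NumberTheory.Transcendental.LinEDSCode
import Literature.NumberTheory.Transcendental.MZVShuffleRegularisation
import Summits.KontsevichZagierPeriods.KontsevichZagierPeriods.Theorems.FurushoPentagonKernelModuloPeriodConjectureRowBitsParitySupport
import Summits.KontsevichZagierPeriods.KontsevichZagierPeriods.Theorems.FurushoPentagonKernelModuloPeriodConjectureFoldDivTestBit
import Summits.KontsevichZagierPeriods.KontsevichZagierPeriods.Theorems.FurushoPentagonKernelModuloPeriodConjectureInsYCount
import Summits.KontsevichZagierPeriods.KontsevichZagierPeriods.Theorems.FurushoPentagonKernelModuloPeriodConjectureColsSpec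
import Summits.KontsevichZagierPeriods.KontsevichZagierPeriods.Theorems.FurushoPentagonKernelModuloPeriodConjectureEvalRowZDivFold
import HarnessLib

/-!
# `KernelModuloPeriodConjecture`, line `Sketch`: row parity (E9), part C — the fold and the parity at a column

Crux `FurushoPentagon.KernelModuloPeriodConjecture` (stmt-KontsevichZagierPeriods-15058), line
`Sketch`, registered stub `stub_rowBits_parity` of the lead's skeleton v11 (soundness of the
kernel-checkable GF(2) rank engine `Literature/NumberTheory/Transcendental/LinEDS.lean`): for a
valid row name, bit `c` (a column) of the kernel's row `LinEDS.rowBits k ν` is the parity of the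
integer matrix entry `LinEDS.entry k ν c` (the folded integer row at the word of `c`); the row has
bits only at columns; the folded integer row is supported on admissible words of weight `k`.
Part C assembles part A (`stub_rowZ_parity_raw`: parity of the raw row), part B
(`stub_rowZ_support_shape`: support words begin with `x` or `y x`, end with `y`), E3
(`stub_foldDiv_testBit`: bits of the fold), E4 (`stub_insY_count`: insertions = shuffle with `y`) and
E8 (`stub_cols_spec`): the fold acts on the integer row as `foldDiv` acts on the bits, and at a column
word the two parities agree (computed in `ZMod 2`).

References: K. Ihara, M. Kaneko, D. Zagier, Compos. Math. 142 (2006) §2 [IharaKanekoZagier2006].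
-/

namespace Summit.KontsevichZagierPeriods.FurushoPentagon.KernelModuloPeriodConjecture

open Literature.NumberTheory.Transcendental
open Literature.NumberTheory.Transcendental.LinEDS

/-! ### The fold at a word not of the form `y x …` -/

/-- `divFoldWord w = e_w` unless `w = y x …`. [folklore] -/
theorem rowE9_divFoldWord_of_not {w : List Bool} (h : ¬ ∃ r, w = true :: false :: r) :
    LinEDS.divFoldWord w = Finsupp.single w 1 := by
  match w, h with
  | [], _ => rfl
  | [b], _ => cases b <;> rfl
  | false :: _ :: _, _ => rfl
  | true :: true :: _, _ => rfl
  | true :: false :: r, h => exact absurd ⟨r, rfl⟩ h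

open Classical in
/-- **The folded row at a word `w₀` not of the form `y x …`**: its own coefficient minus the
divergent coefficients weighted by the multiplicity of `w₀` among the insertions.
[cite: IharaKanekoZagier2006, §2] -/
theorem rowE9_divFold_apply (f : List Bool →₀ ℤ) {w₀ : List Bool}
    (h₀ : ¬ ∃ r, w₀ = true :: false :: r) :
    LinEDS.divFold f w₀ = f w₀ - ∑ w ∈ f.support.filter (fun w => ∃ r, w = true :: false :: r),
      f w * ((((MZV.shuffleWord [true] (w.drop 2)).map (List.cons false)).count w₀ : ℕ) : ℤ) := by
  classical
  rw [LinEDS.divFold, Finsupp.sum, Finsupp.finsetSum_apply,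
    ← Finset.sum_filter_add_sum_filter_not f.support (fun w => ∃ r, w = true :: false :: r),
    sub_eq_add_neg, add_comm, ← Finset.sum_neg_distrib]
  congr 1
  · rw [Finset.sum_congr rfl (g := fun w => if w = w₀ then f w else 0)]
    · rw [Finset.sum_ite_eq']
      split_ifs with hw
      · rfl
      · rw [eq_comm, ← Finsupp.notMem_support_iff]
        intro hw₀
        exact hw (Finset.mem_filter.mpr ⟨hw₀, h₀⟩)
    · intro w hw
      rw [Finset.mem_filter] at hw
      rw [Finsupp.smul_apply, rowE9_divFoldWord_of_not hw.2, Finsupp.single_apply, smul_eq_mul]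
      split_ifs <;> simp
  · refine Finset.sum_congr rfl fun w hw => ?_
    obtain ⟨-, r, rfl⟩ := Finset.mem_filter.mp hw
    rw [Finsupp.smul_apply, smul_eq_mul, show LinEDS.divFoldWord (true :: false :: r) =
      -LinEDS.wordSumZ ((MZV.shuffleWord [true] r).map (List.cons false)) from rfl,
      Finsupp.neg_apply, rowE9_wordSumZ_apply]
    simp

/-! ### Bookkeeping: `wordOfCode`, counts on `List.range` -/

/-- Peeling the first letter of `wordOfCode`. [folklore] -/
theorem rowE9_wordOfCode_succ (m c : ℕ) :
    LinEDS.wordOfCode (m + 1) c = c.testBit m :: LinEDS.wordOfCode m c := by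
  simp [LinEDS.wordOfCode, List.range_succ]

/-- A count over `List.range n` is the cardinality of the filtered `Finset.range n`. [folklore] -/
theorem rowE9_countP_range (n : ℕ) (p : ℕ → Prop) [DecidablePred p] :
    ((List.range n).countP fun j => decide (p j)) = ((Finset.range n).filter p).card := by
  rw [List.countP_eq_length_filter, ← List.toFinset_card_of_nodup ((List.nodup_range).filter _),
    List.toFinset_filter, List.toFinset_range]
  congr 1; ext j; simp

/-- The divergent coefficient's weight at a column word is the number of insertions hitting it
(E4). [folklore] -/
theorem rowE9_count_insertions {m c : ℕ} (hc : c < 2 ^ (m + 1)) {r : List Bool} (hr : r.length = m) :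
    (((MZV.shuffleWord [true] r).map (List.cons false)).count
        (false :: LinEDS.wordOfCode (m + 1) c) : ℕ) =
      ((Finset.range (m + 1)).filter fun j => LinEDS.insY (LinEDS.code r) j = c).card := by
  subst hr
  rw [List.count_map_of_injective _ _ (List.cons_injective), List.count_eq_countP,
    ← rowE9_countP_range, stub_insY_count r c]
  refine List.countP_congr fun v hv => ?_
  have hvl : v.length = r.length + 1 := by
    rw [MZV.length_of_mem_shuffleWord _ _ hv, List.length_singleton, add_comm]
  simp only [beq_iff_eq, decide_eq_true_eq]
  constructor
  · rintro rfl; exact code_wordOfCode hc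
  · intro h; exact code_injective (by rw [hvl, length_wordOfCode]) (by rw [h, code_wordOfCode hc])

/-! ### The main parity computation, in `ZMod 2` -/

/-- **Row parity at a column** (the heart of E9): for a valid name and a column `c`, bit `c` of
`rowBits k ν` is the parity of `entry k ν c`. [cite: IharaKanekoZagier2006, §2] -/
theorem rowE9_parity_at_col {k : ℕ} {ν : List ℕ × List ℕ} (h : LinEDS.validName k ν = true)
    {c : ℕ} (hcol : c ∈ LinEDS.cols k) :
    (LinEDS.rowBits k ν).testBit c = true ↔ Odd (LinEDS.entry k ν c) := by
  classical
  obtain ⟨a, s', b, t', h1, h2, ha, hs', hb, ht', -, hk⟩ := rowE9_validName h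
  have hs : ∀ i ∈ ν.1, 1 ≤ i := by rw [h1]; exact List.forall_mem_cons.mpr ⟨by omega, hs'⟩
  have ht : ∀ i ∈ ν.2, 1 ≤ i := by rw [h2]; exact List.forall_mem_cons.mpr ⟨hb, ht'⟩
  have hk3 : 3 ≤ k := by rw [← hk, h1, h2]; simp; omega
  obtain ⟨m, rfl⟩ : ∃ m, k = m + 2 := ⟨k - 2, by omega⟩
  have hk2 : 2 ≤ m + 2 := by omega
  obtain ⟨-, hcols, -, hmask⟩ := stub_cols_spec (m + 2) hk2
  obtain ⟨hc, hodd, -⟩ := (hcols c).mp hcol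
  simp only [show m + 2 - 1 = m + 1 from rfl] at hc
  -- the column word
  set w₀ := LinEDS.wordOfCode (m + 2) c with hw₀
  have hw₀' : w₀ = false :: LinEDS.wordOfCode (m + 1) c := by
    rw [hw₀, rowE9_wordOfCode_succ, Nat.testBit_eq_false_of_lt hc]
  have h₀ : ¬ ∃ r, w₀ = true :: false :: r := by rw [hw₀']; rintro ⟨r, hr⟩; simp at hr
  have hw₀l : w₀.length = ν.1.sum + ν.2.sum := by rw [hw₀, length_wordOfCode, hk]
  have hcw₀ : LinEDS.code w₀ = c :=
    code_wordOfCode (lt_of_lt_of_le hc (Nat.pow_le_pow_right (by norm_num) (by omega)))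
  -- (vii) the row bit is the fold bit
  have hrow : (LinEDS.rowBits (m + 2) ν).testBit c = (LinEDS.foldDiv (m + 2) (LinEDS.rawBits ν)).testBit c := by
    rw [LinEDS.rowBits, Nat.testBit_land, (hmask c).mpr hcol, Bool.and_true]
  -- (vi) E3
  have hE3 := stub_foldDiv_testBit (m + 2) (LinEDS.rawBits ν) hk2 (rowE9_rawBits_support h) c
  simp only [Nat.add_sub_cancel, show m + 2 - 1 = m + 1 from rfl] at hE3
  rw [hrow, hE3, and_iff_right hc, ← ZMod.natCast_eq_one_iff_odd, rowE9_odd_iff_cast_eq_one]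
  -- both sides are now statements `(_ : ZMod 2) = 1`; show the two elements are equal
  suffices heq : (((if (LinEDS.rawBits ν).testBit c then 1 else 0) + ∑ u ∈ Finset.range (2 ^ m),
      if (LinEDS.rawBits ν).testBit (2 ^ (m + 1) + u) then
        ((Finset.range (m + 1)).filter fun j => LinEDS.insY u j = c).card else 0 : ℕ) : ZMod 2) =
      ((LinEDS.entry (m + 2) ν c : ℤ) : ZMod 2) by
    rw [heq]
  -- the weight function
  set G : ℕ → ZMod 2 := fun u => (((LinEDS.rawBits ν).testBit (2 ^ (m + 1) + u)).toNat : ZMod 2) *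
    (((Finset.range (m + 1)).filter fun j => LinEDS.insY u j = c).card : ZMod 2) with hG
  have lhs : (((if (LinEDS.rawBits ν).testBit c then 1 else 0) + ∑ u ∈ Finset.range (2 ^ m),
      if (LinEDS.rawBits ν).testBit (2 ^ (m + 1) + u) then
        ((Finset.range (m + 1)).filter fun j => LinEDS.insY u j = c).card else 0 : ℕ) : ZMod 2) =
      (((LinEDS.rawBits ν).testBit c).toNat : ZMod 2) + ∑ u ∈ Finset.range (2 ^ m), G u := by
    push_cast
    congr 1
    · cases (LinEDS.rawBits ν).testBit c <;> simp
    · refine Finset.sum_congr rfl fun u _ => ?_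
      rw [hG]
      by_cases hb : (LinEDS.rawBits ν).testBit (2 ^ (m + 1) + u) = true <;> simp [hb]
  -- the right-hand side: unfold the entry
  set f := LinEDS.rowZ ν with hf
  set S₁ := f.support.filter (fun w => ∃ r, w = true :: false :: r) with hS₁
  have rhs : ((LinEDS.entry (m + 2) ν c : ℤ) : ZMod 2) =
      (((LinEDS.rawBits ν).testBit c).toNat : ZMod 2) + ∑ w ∈ S₁, G (LinEDS.code (w.drop 2)) := by
    rw [LinEDS.entry, ← hw₀, ← hf, rowE9_divFold_apply f h₀, Int.cast_sub, sub_eq_add_neg,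
      ZMod.neg_eq_self_mod_two, rowE9_rowZ_cast_eq_bit hs ht hw₀l, hcw₀, Int.cast_sum]
    congr 1
    refine Finset.sum_congr rfl fun w hw => ?_
    obtain ⟨hwsupp, r, rfl⟩ := Finset.mem_filter.mp hw
    obtain ⟨hlen, -, -⟩ := rowE9_support_shape h hwsupp
    have hrl : r.length = m := by simp at hlen; omega
    rw [Int.cast_mul, Int.cast_natCast, hG]
    simp only [List.drop_succ_cons, List.drop_zero]
    congr 1
    · rw [rowE9_rowZ_cast_eq_bit hs ht (by rw [← hk] at hlen; exact hlen), code_cons, code_cons]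
      simp [hrl, List.length_cons]
    · rw [hw₀', rowE9_count_insertions (by omega) hrl]
  rw [lhs, rhs]
  congr 1
  -- (v) reindex the sum over the divergent support by the codes `u < 2^m`
  symm
  have hinj : Set.InjOn (fun w : List Bool => LinEDS.code (w.drop 2)) ↑S₁ := by
    intro w hw w' hw' he
    obtain ⟨hws, r, rfl⟩ := Finset.mem_filter.mp (Finset.mem_coe.mp hw)
    obtain ⟨hws', r', rfl⟩ := Finset.mem_filter.mp (Finset.mem_coe.mp hw')
    obtain ⟨hl, -, -⟩ := rowE9_support_shape h hws
    obtain ⟨hl', -, -⟩ := rowE9_support_shape h hws'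
    simp only [List.drop_succ_cons, List.drop_zero] at he
    simp only [List.length_cons] at hl hl'
    rw [code_injective (by omega) he]
  rw [← Finset.sum_image hinj]
  apply Finset.sum_subset
  · intro u hu
    obtain ⟨w, hw, rfl⟩ := Finset.mem_image.mp hu
    obtain ⟨hws, r, rfl⟩ := Finset.mem_filter.mp hw
    obtain ⟨hl, -, -⟩ := rowE9_support_shape h hws
    simp only [List.drop_succ_cons, List.drop_zero, Finset.mem_range]
    have := code_lt r
    simp only [List.length_cons] at hl
    rwa [show r.length = m by omega] at this
  · intro u hu hnot
    rw [hG]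
    cases hbit : (LinEDS.rawBits ν).testBit (2 ^ (m + 1) + u)
    · simp [hbit]
    · exfalso
      apply hnot
      rw [Finset.mem_range] at hu
      set w := true :: false :: LinEDS.wordOfCode m u with hw
      have hwl : w.length = ν.1.sum + ν.2.sum := by rw [hw, hk]; simp [length_wordOfCode]
      have hcw : LinEDS.code w = 2 ^ (m + 1) + u := by
        rw [hw, code_cons, code_cons, code_wordOfCode hu]; simp [length_wordOfCode]
      have hoddw : Odd (f w) := (rowE9_odd_rowZ_iff hs ht hwl).mpr (by rw [hcw, hbit])
      have hws : w ∈ f.support := by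
        rw [Finsupp.mem_support_iff]; intro h0; rw [h0] at hoddw
        exact (by decide : ¬ Odd (0 : ℤ)) hoddw
      refine Finset.mem_image.mpr ⟨w, Finset.mem_filter.mpr ⟨hws, _, rfl⟩, ?_⟩
      simp [hw, code_wordOfCode hu]

/-! ### The registered stub -/

/-- **E9 — row parity** (registered stub `stub_rowBits_parity` of the lead's skeleton v11, crux
stmt-KontsevichZagierPeriods-15058, line `Sketch`). For a valid name, bit `c` (a column) of
`rowBits k ν` is the parity of the integer matrix entry `entry k ν c`; the row bitset has bits only
at columns; and the folded integer row is supported on admissible words of weight `k`.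
[cite: IharaKanekoZagier2006, §2] -/
theorem stub_rowBits_parity :
    ∀ (k : ℕ) (ν : List ℕ × List ℕ), LinEDS.validName k ν = true →
      (∀ c ∈ LinEDS.cols k, (LinEDS.rowBits k ν).testBit c = true ↔ Odd (LinEDS.entry k ν c)) ∧
      (∀ i, (LinEDS.rowBits k ν).testBit i = true → i ∈ LinEDS.cols k) ∧
      (∀ w ∈ (LinEDS.divFold (LinEDS.rowZ ν)).support,
        w.length = k ∧ w.head? = some false ∧ w.getLast? = some true) := by
  classical
  intro k ν h
  obtain ⟨a, s', b, t', h1, h2, ha, -, -, -, -, hk⟩ := rowE9_validName h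
  have hk2 : 2 ≤ k := by rw [← hk, h1]; simp; omega
  obtain ⟨-, -, -, hmask⟩ := stub_cols_spec k hk2
  refine ⟨fun c hc => rowE9_parity_at_col h hc, fun i hi => ?_, fun w₀ hw₀ => ?_⟩
  · rw [LinEDS.rowBits, Nat.testBit_land, Bool.and_eq_true] at hi
    exact (hmask i).mp hi.2
  · rw [Finsupp.mem_support_iff, LinEDS.divFold, Finsupp.sum, Finsupp.finsetSum_apply] at hw₀
    obtain ⟨w, hw, hne⟩ := Finset.exists_ne_zero_of_sum_ne_zero hw₀
    rw [Finsupp.smul_apply, smul_eq_mul] at hne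
    have hne' : LinEDS.divFoldWord w w₀ ≠ 0 := fun h0 => hne (by rw [h0, mul_zero])
    obtain ⟨hlen, hshape, hlast⟩ := rowE9_support_shape h hw
    by_cases hyx : ∃ r, w = true :: false :: r
    · obtain ⟨r, rfl⟩ := hyx
      rw [show LinEDS.divFoldWord (true :: false :: r) =
        -LinEDS.wordSumZ ((MZV.shuffleWord [true] r).map (List.cons false)) from rfl,
        Finsupp.neg_apply, neg_ne_zero, rowE9_wordSumZ_apply, Nat.cast_ne_zero,
        ← Nat.pos_iff_ne_zero, List.count_pos_iff, List.mem_map] at hne'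
      obtain ⟨v, hv, rfl⟩ := hne'
      have hvl : v.length = r.length + 1 := by
        rw [MZV.length_of_mem_shuffleWord _ _ hv, List.length_singleton, add_comm]
      refine ⟨by simp at hlen ⊢; omega, rfl, ?_⟩
      have hvlast : v.getLast? = some true := by
        cases r with
        | nil => rw [MZV.shuffleWord_nil_right, List.mem_singleton] at hv; subst hv; rfl
        | cons x r' =>
          refine rowE9_shuffle_getLast [true] (x :: r') (by simp) (by simp) rfl ?_ v hv
          simpa using hlast
      have hvne : v ≠ [] := by rintro rfl; simp at hvl
      rw [List.getLast?_cons, hvlast]; cases v <;> simp_all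
    · rw [rowE9_divFoldWord_of_not hyx, Finsupp.single_apply] at hne'
      split_ifs at hne' with hww
      · subst hww
        exact ⟨hlen, hshape.resolve_right hyx, hlast⟩
      · exact absurd rfl hne'

end Summit.KontsevichZagierPeriods.FurushoPentagon.KernelModuloPeriodConjecture
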